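import Literature.AlgebraicGeometry.HodgeTheory.ComplementLocalTrivialityRationalOpen
import Literature.AlgebraicGeometry.HodgeTheory.SupportedLocusClosed
import HarnessLib

/-!
# Death of a global class off a `k`-closed subset is constant over a `k`-rational open of the base

Topic `Literature/AlgebraicGeometry/HodgeTheory` (family `hodge`). Theorems only (no definition, no
named fact; D-0026). Sequel of `ComplementLocalTrivialityRationalOpen.lean` (over a `k`-rational
open `O₀ ∋ η_{B₀}` the complement `{x ∈ X(ℂ) ∖ C(ℂ) | g x ∈ O}` of a `k`-closed subset in a smooth
proper family defined over `k` is a locally trivial fibration) and of `SupportedLocusClosed.lean`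
(upper semicontinuity of supports: the set of parameters where a class dies off a closed subfamily
is CLOSED). Here the two are combined into the LOCAL CONSTANCY used by the spreading argument for
the variational Hodge conjecture (Voisin, *Hodge Theory II*, §3.3.1; Charles–Schnell 2014, proof
of Prop. 11.3.11, "on each connected component the condition is constant"):

* `isOpen_setOf_map_subtypeVal_fiber_eq_zero` — pure topology: for a locally trivial fibration
  `p : E → B` over a locally path connected base and `A ∈ Hᵏ(E; F)`, **the set of `b` with
  `A|_{p⁻¹(b)} = 0` is OPEN** (move compacta along paths inside a trivialising neighbourhood;
  Hatcher Thm. 2.10, 3.2); with the closedness of the tree,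
  `map_subtypeVal_fiber_eq_zero_iff_of_preconnectedSpace` — over a CONNECTED locally path
  connected base, death on one fibre is death on every fibre.
* `map_fiberι_mem_ker_restrictCompl_iff_of_baseChangeHom` — **on the real carriers**: for
  `σ : k →+* ℂ` (`k` of characteristic zero), `g₀ : X₀ ⟶ B₀` proper smooth between `k`-schemes
  (`X₀` integral; `B₀` integral, separated, quasi-compact, of finite type, smooth over `k`, with
  irreducible complexification `B`), `C₀ ⊆ X₀` closed and `A ∈ Hᵏ(X(ℂ); ℂ)`, there is an open
  `O₀ ∋ η_{B₀}` of `B₀` such that for any two complex points `y, y'` of `B` over `O₀`: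
  `A|_{X_y}` dies off `X_y ∩ π_X⁻¹ C₀` iff `A|_{X_{y'}}` dies off `X_{y'} ∩ π_X⁻¹ C₀`
  (`complexBetti.restrictCompl` of the scheme-theoretic fibres). A `k`-generic `y` lies over
  `O₀`, so death at the generic parameter propagates to every parameter over `O₀`.

## References

* [VoisinHodgeI2002] C. Voisin, Hodge Theory and Complex Algebraic Geometry I (2002), §9.1.1,
  Thm. 9.3.
* [VoisinHodgeII2003] C. Voisin, Hodge Theory and Complex Algebraic Geometry II (2003), §3.3.1.
* [CharlesSchnell2014Notes] F. Charles, C. Schnell, Notes on absolute Hodge classes (2014),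
  Prop. 11.3.11 (proof), Lemma 11.3.14.
* [HatcherAT2002] A. Hatcher, Algebraic Topology (2002), Thm. 2.10, §3.1 Thm. 3.2, §3.3.
-/

noncomputable section

open CategoryTheory AlgebraicGeometry Limits Set TopologicalSpace Filter
open MonoidalCategory CartesianMonoidalCategory
open _root_.Topology
open Literature.AlgebraicGeometry.Motives Literature.AlgebraicTopology.Homotopy
open Literature.AlgebraicTopology.SingularHomology

namespace Literature.AlgebraicGeometry.HodgeTheory

universe u v

/-! ### Topology: death on the fibres of a locally trivial fibration is an open condition -/

section Topology

variable (F : Type v) [Field F] {E B : Type u} [TopologicalSpace E] [TopologicalSpace B]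

/-- **Death of a class on the fibres of a locally trivial fibration is an OPEN condition on the
base** (`B` locally path connected): if `A ∈ Hᵏ(E; F)` dies on `p⁻¹(b₀)` and `b` lies in a path
connected trivialising neighbourhood of `b₀`, every compact `K ⊆ p⁻¹(b)` is moved by the
trivialisation, along a path from `b` to `b₀`, into `p⁻¹(b₀)`, by a homotopy in `E` starting at
`K ↪ E`; so `A|_{p⁻¹(b)}` pairs to zero with every homology class
(`singularCohomology_map_eq_zero_of_compact_homotopy`). Companion of the CLOSEDNESS
`isClosed_setOf_map_subtypeVal_eq_zero_of_isLocallyTrivialFibration` (there for the fibres off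
a closed subfamily; openness needs the subfamily empty, i.e. the fibration to be that of the
complement itself). [cite: HatcherAT2002, §3.1 Thm. 3.2, §3.3 p. 244, Thm. 2.10]
[cite: VoisinHodgeI2002, §9.1.1] -/
theorem isOpen_setOf_map_subtypeVal_fiber_eq_zero {p : E → B} (hp : IsLocallyTrivialFibration p)
    [LocallyPathConnectedSpace B] {k : ℕ} (A : singularCohomology F F E k) :
    IsOpen {b : B | singularCohomology.map F F
      (⟨Subtype.val, continuous_subtype_val⟩ : C({e : E // p e = b}, E)) k A = 0} := by
  refine isOpen_iff_mem_nhds.2 fun b₀ hb₀ => ?_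
  -- a local trivialisation near `b₀` and a path connected neighbourhood inside it
  obtain ⟨V, hVo, hV₀, φ, hφ⟩ := hp b₀
  obtain ⟨W, ⟨hWn, hWpc, hWV⟩, -⟩ :=
    (pathConnected_subset_basis hVo hV₀).mem_iff.1 (hVo.mem_nhds hV₀)
  refine mem_of_superset hWn fun b hbW => ?_
  have hbV : b ∈ V := hWV hbW
  change singularCohomology.map F F
    (⟨Subtype.val, continuous_subtype_val⟩ : C({e : E // p e = b}, E)) k A = 0
  apply singularCohomology_map_eq_zero_of_compact_homotopy
  intro K hK
  haveI : CompactSpace K := isCompact_iff_compactSpace.1 hK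
  -- points of `K` as points of `p⁻¹ V` and their fibre coordinates (in `p⁻¹(b₀)`)
  have hKV : ∀ κ : K, (κ : {e : E // p e = b}).1 ∈ p ⁻¹' V := fun κ => by
    rw [mem_preimage, κ.1.2]; exact hbV
  let ξ : K → ↥(p ⁻¹' {b₀}) := fun κ => (φ.symm ⟨_, hKV κ⟩).2
  have hξ : Continuous ξ :=
    continuous_snd.comp (φ.symm.continuous.comp ((continuous_subtype_val.comp
      continuous_subtype_val).subtype_mk _))
  have hφξ : ∀ κ : K, (φ (⟨b, hbV⟩, ξ κ) : E) = (κ : {e : E // p e = b}).1 := fun κ => by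
    have h1 : (φ.symm ⟨_, hKV κ⟩).1 = ⟨b, hbV⟩ := by
      apply Subtype.ext
      have := hφ (φ.symm ⟨_, hKV κ⟩)
      rw [φ.apply_symm_apply] at this
      rw [← this]
      exact κ.1.2
    change (φ (⟨b, hbV⟩, (φ.symm ⟨_, hKV κ⟩).2) : E) = _
    rw [← h1, Prod.mk.eta, φ.apply_symm_apply]
  -- the motion of `K` into the fibre over `b' ∈ V`
  let Θ : V × K → E := fun x => φ (x.1, ξ x.2)
  have hΘ : Continuous Θ :=
    continuous_subtype_val.comp (φ.continuous.comp (continuous_fst.prodMk (hξ.comp continuous_snd)))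
  have hpΘ : ∀ x : V × K, p (Θ x) = x.1 := fun x => hφ _
  -- the target: `p⁻¹(b₀)`, where `A` dies
  let ψ : C(K, {e : E // p e = b₀}) :=
    ⟨fun κ => ⟨Θ (⟨b₀, hV₀⟩, κ), hpΘ _⟩,
      (hΘ.comp (continuous_const.prodMk continuous_id)).subtype_mk _⟩
  refine ⟨{e : E // p e = b₀}, inferInstance, ⟨Subtype.val, continuous_subtype_val⟩, ψ, hb₀, ?_⟩
  -- the motion along a path from `b` to `b₀` in `W ⊆ V` is the homotopy
  have hJ : JoinedIn W b b₀ := hWpc.joinedIn _ hbW _ (mem_of_mem_nhds hWn)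
  let γ : Path b b₀ := hJ.somePath
  have hγ : ∀ s, γ s ∈ V := fun s => hWV (hJ.somePath_mem s)
  refine ⟨ContinuousMap.Homotopy.symm ⟨⟨fun x => Θ (⟨γ x.1, hγ x.1⟩, x.2), ?_⟩, ?_, ?_⟩⟩
  · exact hΘ.comp (((γ.continuous.comp continuous_fst).subtype_mk _).prodMk continuous_snd)
  · intro κ
    change Θ (⟨γ 0, hγ 0⟩, κ) = (κ : {e : E // p e = b}).1
    have h0 : (⟨γ 0, hγ 0⟩ : V) = ⟨b, hbV⟩ := Subtype.ext γ.source
    rw [h0]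
    exact hφξ κ
  · intro κ
    change Θ (⟨γ 1, hγ 1⟩, κ) = Θ (⟨b₀, hV₀⟩, κ)
    have h1 : (⟨γ 1, hγ 1⟩ : V) = ⟨b₀, hV₀⟩ := Subtype.ext γ.target
    rw [h1]

/-- Death of a class is insensitive to replacing the source by a homeomorphic space over `E`
(functoriality of singular cohomology, Hatcher §3.1). [cite: HatcherAT2002, §3.1 (induced homomorphisms, p. 201)] -/
theorem map_eq_zero_iff_of_homeomorph {U U' : Type u} [TopologicalSpace U] [TopologicalSpace U']
    (i : C(U, E)) (j : C(U', E)) (e : U ≃ₜ U') (he : ∀ u, j (e u) = i u) {k : ℕ}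
    (A : singularCohomology F F E k) :
    singularCohomology.map F F i k A = 0 ↔ singularCohomology.map F F j k A = 0 := by
  have hij : i = j.comp (e : C(U, U')) := by ext u; exact (he u).symm
  have hji : j = i.comp (e.symm : C(U', U)) := by
    ext u
    have := he (e.symm u)
    rw [e.apply_symm_apply] at this
    exact this
  constructor
  · intro h
    rw [hji, singularCohomology.map_comp, ModuleCat.comp_apply, h, map_zero]
  · intro h
    rw [hij, singularCohomology.map_comp, ModuleCat.comp_apply, h, map_zero]

/-- **Death on the fibres of a locally trivial fibration over a connected, locally path connected
base is constant**: closed (`isClosed_setOf_map_subtypeVal_eq_zero_of_isLocallyTrivialFibration`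
with the empty subfamily) and open (`isOpen_setOf_map_subtypeVal_fiber_eq_zero`).
[cite: VoisinHodgeI2002, §9.1.1] -/
theorem map_subtypeVal_fiber_eq_zero_iff_of_preconnectedSpace {p : E → B}
    (hp : IsLocallyTrivialFibration p) [LocallyPathConnectedSpace B] [PreconnectedSpace B] {k : ℕ}
    (A : singularCohomology F F E k) (b b' : B) :
    singularCohomology.map F F (⟨Subtype.val, continuous_subtype_val⟩ : C({e : E // p e = b}, E)) k A =
        0 ↔
      singularCohomology.map F F (⟨Subtype.val, continuous_subtype_val⟩ : C({e : E // p e = b'}, E))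
        k A = 0 := by
  let G : Set B := {b : B | singularCohomology.map F F
      (⟨Subtype.val, continuous_subtype_val⟩ : C({e : E // p e = b}, E)) k A = 0}
  have hopen : IsOpen G := isOpen_setOf_map_subtypeVal_fiber_eq_zero F hp A
  -- closedness: the closed-family lemma with the empty family, up to the shape of the fibre
  have hclosed : IsClosed G := by
    have h := isClosed_setOf_map_subtypeVal_eq_zero_of_isLocallyTrivialFibration F hp
      (ContinuousMap.id B) (C := (∅ : Set (B × E))) isClosed_empty A
    have hG : G = {y : B | singularCohomology.map F F (⟨Subtype.val, continuous_subtype_val⟩ :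
        C({e : E // p e = (ContinuousMap.id B) y ∧ (y, e) ∉ (∅ : Set (B × E))}, E)) k A = 0} := by
      ext y
      exact map_eq_zero_iff_of_homeomorph F
        (⟨Subtype.val, continuous_subtype_val⟩ : C({e : E // p e = y}, E))
        (⟨Subtype.val, continuous_subtype_val⟩ :
          C({e : E // p e = (ContinuousMap.id B) y ∧ (y, e) ∉ (∅ : Set (B × E))}, E))
        { toFun := fun u => ⟨u.1, u.2, fun h => h⟩
          invFun := fun u => ⟨u.1, u.2.1⟩
          left_inv := fun u => rfl
          right_inv := fun u => rfl
          continuous_toFun := continuous_subtype_val.subtype_mk _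
          continuous_invFun := continuous_subtype_val.subtype_mk _ } (fun u => rfl) A
    rw [hG]
    exact h
  have hclopen : IsClopen G := ⟨hclosed, hopen⟩
  rcases isClopen_iff.1 hclopen with hG | hG
  · constructor
    · intro hb; have : b ∈ G := hb; rw [hG] at this; exact this.elim
    · intro hb'; have : b' ∈ G := hb'; rw [hG] at this; exact this.elim
  · constructor
    · intro _; have : b' ∈ G := hG ▸ mem_univ _; exact this
    · intro _; have : b ∈ G := hG ▸ mem_univ _; exact this

end Topology

/-! ### Schemes: death off a closed subset defined over `k` is constant over a `k`-rational open -/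

section Schemes

variable {k : Type} [Field k] [CharZero k] (σ : k →+* ℂ) {X₀ B₀ : SchemeOver k} (g₀ : X₀ ⟶ B₀)
  {n d : ℕ}

omit [CharZero k] in
/-- `Spec ℂ → Spec k` is surjective (one point onto one point). [folklore] -/
private theorem surjective_specMap : Surjective (Spec.map (CommRingCat.ofHom σ)) := by
  haveI : Subsingleton ↥(Spec (CommRingCat.of k)) :=
    inferInstanceAs (Subsingleton (PrimeSpectrum k))
  exact ⟨fun x ↦ ⟨(default : ↥(Spec (CommRingCat.of ℂ))), Subsingleton.elim _ _⟩⟩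

/-- **Death of a global class off a `k`-closed subset is constant over a `k`-rational open.**
Let `σ : k →+* ℂ` (`k` of characteristic zero), `g₀ : X₀ ⟶ B₀` proper and smooth of relative
dimension `n` with `X₀` integral, `B₀` integral, separated, quasi-compact, locally of finite type
and smooth of relative dimension `d` over `k`, with IRREDUCIBLE complexification `B = B₀ ⊗_σ ℂ`,
`C₀ ⊆ X₀` closed and `A ∈ Hᵏ(X(ℂ); ℂ)` a class on the complexified total space `X = X₀ ⊗_σ ℂ`.
Then there is an open `O₀ ⊆ B₀` containing the generic point of `B₀` such that for any two
complex points `y, y'` of `B` over `O₀`, `A|_{X_y}` dies off the slice `X_y ∩ π_X⁻¹C₀` iff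
`A|_{X_{y'}}` dies off `X_{y'} ∩ π_X⁻¹C₀`. Proof: over `O₀` the complement family is a locally
trivial fibration (`exists_opens_isLocallyTrivialFibration_compl_of_baseChangeHom`); death on its
fibres is open (`isOpen_setOf_map_subtypeVal_fiber_eq_zero`) and closed (upper semicontinuity of
supports, `isClosed_setOf_map_subtypeVal_eq_zero_of_isLocallyTrivialFibration`) on the connected
set of complex points over `O₀` (`ComplexPoints.isConnected_setOf_pt_mem_inter_of_isIrreducible`),
and the fibres of the scheme-theoretic fibre off the slice are the topological ones
(`map_fiberι_mem_ker_restrictCompl_iff`). In the spreading argument for the variational Hodge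
conjecture this is applied with `y` a `k`-GENERIC point (which lies over `O₀`): a class dying off
the spread support at the generic parameter dies off it at EVERY parameter over `O₀`.
[cite: VoisinHodgeI2002, §9.1.1, Thm. 9.3] [cite: CharlesSchnell2014Notes, Prop. 11.3.11 (proof) and Lemma 11.3.14] -/
theorem map_fiberι_mem_ker_restrictCompl_iff_of_baseChangeHom
    [IsProper g₀.left] [SmoothOfRelativeDimension n g₀.left] [IsIntegral X₀.left]
    [IsIntegral B₀.left] [LocallyOfFiniteType B₀.hom] [SmoothOfRelativeDimension d B₀.hom]
    [IsSeparated B₀.hom] [CompactSpace B₀.left]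
    [IrreducibleSpace ((baseChangeHom σ).obj B₀).left] (C₀ : Set X₀.left) (hC₀ : IsClosed C₀)
    (kk : ℕ) (A : complexBetti ((baseChangeHom σ).obj X₀) kk) :
    ∃ O₀ : B₀.left.Opens, genericPoint B₀.left ∈ O₀ ∧
      ∀ y y' : ComplexPoints ((baseChangeHom σ).obj B₀),
        baseChangeHomFst σ B₀ y.pt ∈ O₀ → baseChangeHomFst σ B₀ y'.pt ∈ O₀ →
        (complexBetti.map (fiberι ((baseChangeHom σ).map g₀) y) kk A ∈
            LinearMap.ker (complexBetti.restrictCompl (fiberOver ((baseChangeHom σ).map g₀) y)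
              ((fiberι ((baseChangeHom σ).map g₀) y).left ⁻¹'
                ((baseChangeHomFst σ X₀) ⁻¹' C₀)) kk).hom ↔
          complexBetti.map (fiberι ((baseChangeHom σ).map g₀) y') kk A ∈
            LinearMap.ker (complexBetti.restrictCompl (fiberOver ((baseChangeHom σ).map g₀) y')
              ((fiberι ((baseChangeHom σ).map g₀) y').left ⁻¹'
                ((baseChangeHomFst σ X₀) ⁻¹' C₀)) kk).hom) := by
  classical
  obtain ⟨O₀, hη, hF⟩ :=
    exists_opens_isLocallyTrivialFibration_compl_of_baseChangeHom σ g₀ (n := n) (d := d) C₀ hC₀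
  refine ⟨O₀, hη, fun y y' hy hy' => ?_⟩
  -- notation
  let X : SchemeOver ℂ := (baseChangeHom σ).obj X₀
  let B : SchemeOver ℂ := (baseChangeHom σ).obj B₀
  let g : X ⟶ B := (baseChangeHom σ).map g₀
  let prX : X.left ⟶ X₀.left := baseChangeHomFst σ X₀
  let prB : B.left ⟶ B₀.left := baseChangeHomFst σ B₀
  -- instances on the complexified data
  have Hg : IsPullback prX g.left g₀.left prB := by
    letI := σ.toAlgebra
    exact (isPullback_baseChange_map_left ℂ g₀).flip
  haveI : IsProper g.left := MorphismProperty.of_isPullback (P := @IsProper) Hg inferInstance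
  haveI : LocallyOfFiniteType X₀.hom := by rw [← Over.w g₀]; infer_instance
  haveI : IsSeparated X₀.hom := by rw [← Over.w g₀]; infer_instance
  haveI : IsSeparated X.hom := by
    change IsSeparated (pullback.snd X₀.hom (Spec.map (CommRingCat.ofHom σ)))
    infer_instance
  haveI : LocallyOfFiniteType B.hom := by
    change LocallyOfFiniteType (pullback.snd B₀.hom (Spec.map (CommRingCat.ofHom σ)))
    infer_instance
  haveI : SmoothOfRelativeDimension d B.hom := smoothOfRelativeDimension_baseChangeHom_hom σ d B₀
  haveI : Smooth B.hom := SmoothOfRelativeDimension.smooth d B.hom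
  haveI : Surjective prB := by
    haveI := surjective_specMap σ
    exact MorphismProperty.pullback_fst (P := @Surjective) _ _ inferInstance
  -- the death condition on the topological fibres off the slice
  let C : Set (ComplexPoints B × ComplexPoints X) := {q | prX q.2.pt ∈ C₀}
  have hT : ∀ z : ComplexPoints B,
      complexBetti.map (fiberι g z) kk A ∈
          LinearMap.ker (complexBetti.restrictCompl (fiberOver g z)
            ((fiberι g z).left ⁻¹' (prX ⁻¹' C₀)) kk).hom ↔
        singularCohomology.map ℂ ℂ (⟨Subtype.val, continuous_subtype_val⟩ :
          C({e : ComplexPoints X // AlgPoints.map g e = z ∧ (z, e) ∉ C}, ComplexPoints X)) kk A = 0 :=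
    fun z => map_fiberι_mem_ker_restrictCompl_iff g (id : ComplexPoints B → ComplexPoints B) C
      (fun z => (fiberι g z).left ⁻¹' (prX ⁻¹' C₀)) (fun z P => Iff.rfl) kk A z
  rw [hT y, hT y']
  -- the complement fibration over `O₀` and its base
  let Osub : Set (ComplexPoints B) := {β | prB β.pt ∈ O₀}
  let EF := {x : ComplexPoints X // prX x.pt ∉ C₀ ∧ prB (g.left x.pt) ∈ O₀}
  let Fm : EF → ↥Osub := fun x => ⟨AlgPoints.map g x.1, x.2.2⟩
  have hFm : IsLocallyTrivialFibration Fm := hF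
  -- the base is locally path connected and connected
  have hOopen : IsOpen Osub := AlgPoints.isOpen_setOf_pt_mem (X := B) (L := ℂ) (prB ⁻¹ᵁ O₀)
  haveI : LocallyPathConnectedSpace (ComplexPoints B) := locallyPathConnectedSpace_complexPoints_of_smooth B
  haveI : LocallyPathConnectedSpace ↥Osub := hOopen.locallyPathConnectedSpace
  have hOne : ((Set.univ : Set B.left) ∩ ((prB ⁻¹ᵁ O₀ : B.left.Opens) : Set B.left)).Nonempty := by
    obtain ⟨b, hb⟩ := (inferInstance : Surjective prB).surj (genericPoint B₀.left)
    refine ⟨b, Set.mem_univ _, ?_⟩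
    change prB b ∈ O₀
    rw [hb]; exact hη
  have hconn : IsConnected Osub := by
    have h := ComplexPoints.isConnected_setOf_pt_mem_inter_of_isIrreducible B isClosed_univ
      (IrreducibleSpace.isIrreducible_univ _) (prB ⁻¹ᵁ O₀) hOne
    have heq : {P : ComplexPoints B | P.pt ∈ (Set.univ : Set B.left) ∧
        P.pt ∈ ((prB ⁻¹ᵁ O₀ : B.left.Opens) : Set B.left)} = Osub := by
      ext P
      simp only [Set.mem_univ, true_and, Set.mem_setOf_eq]
      rfl
    rwa [heq] at h
  haveI : PreconnectedSpace ↥Osub := Subtype.preconnectedSpace hconn.isPreconnected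
  -- the class pulled back to the total space of the complement fibration
  let ιE : C(EF, ComplexPoints X) := ⟨Subtype.val, continuous_subtype_val⟩
  let A' : singularCohomology ℂ ℂ EF kk := singularCohomology.map ℂ ℂ ιE kk A
  have hconst := map_subtypeVal_fiber_eq_zero_iff_of_preconnectedSpace ℂ hFm A' ⟨y, hy⟩ ⟨y', hy'⟩
  -- death on a fibre of `Fm` versus death on the fibre off the slice, for `A`
  have hfib : ∀ (z : ComplexPoints B) (hz : prB z.pt ∈ O₀),
      singularCohomology.map ℂ ℂ (⟨Subtype.val, continuous_subtype_val⟩ :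
          C({e : EF // Fm e = ⟨z, hz⟩}, EF)) kk A' = 0 ↔
        singularCohomology.map ℂ ℂ (⟨Subtype.val, continuous_subtype_val⟩ :
          C({e : ComplexPoints X // AlgPoints.map g e = z ∧ (z, e) ∉ C}, ComplexPoints X)) kk A = 0 := by
    intro z hz
    have hcomp : singularCohomology.map ℂ ℂ (⟨Subtype.val, continuous_subtype_val⟩ :
        C({e : EF // Fm e = ⟨z, hz⟩}, EF)) kk A' =
        singularCohomology.map ℂ ℂ (ιE.comp (⟨Subtype.val, continuous_subtype_val⟩ :
          C({e : EF // Fm e = ⟨z, hz⟩}, EF))) kk A := by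
      change singularCohomology.map ℂ ℂ _ kk (singularCohomology.map ℂ ℂ ιE kk A) = _
      rw [← ModuleCat.comp_apply, ← singularCohomology.map_comp]
    rw [hcomp]
    refine (map_eq_zero_iff_of_homeomorph ℂ
      (⟨Subtype.val, continuous_subtype_val⟩ :
        C({e : ComplexPoints X // AlgPoints.map g e = z ∧ (z, e) ∉ C}, ComplexPoints X))
      (ιE.comp (⟨Subtype.val, continuous_subtype_val⟩ : C({e : EF // Fm e = ⟨z, hz⟩}, EF)))
      { toFun := fun u => ⟨⟨u.1, u.2.2, by
            have h1 : g.left u.1.pt = z.pt := by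
              rw [← AlgPoints.pt_map, u.2.1]
            change prB (g.left u.1.pt) ∈ O₀
            rw [h1]; exact hz⟩, Subtype.ext u.2.1⟩
        invFun := fun x => ⟨x.1.1, congrArg Subtype.val x.2, x.1.2.1⟩
        left_inv := fun u => rfl
        right_inv := fun x => rfl
        continuous_toFun := ((continuous_subtype_val.subtype_mk _).subtype_mk _)
        continuous_invFun := (continuous_subtype_val.comp continuous_subtype_val).subtype_mk _ }
      (fun u => rfl) A).symm
  rw [← hfib y hy, ← hfib y' hy']
  exact hconst

end Schemes

end Literature.AlgebraicGeometry.HodgeTheory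

end
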